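import Mathlib
import HarnessLib
import HarnessLib.Audit
import Summits.KontsevichZagierPeriods.Statement
import Literature.NumberTheory.Transcendental.MZVSimplexRepProofs
import HarnessLib.Audit.Status.Attr

/-!
Route: SiegelTamagawa

DORMANT since 2026-08-23T16:14:00Z (reconciler: no traction for 6.1 d (last activity item-proof-filed at 2026-08-17T12:55:35Z); parked, not closed — `ledger route dormant route-KontsevichZagierPeriods-SiegelTamagawa --off` to reactivate) — unstaffed, not closed; items shared with open routes are served there. `ledger route dormant <id> --off` reactivates.

# Route SiegelTamagawa — Minkowski's ζ(3)/6 body decided inside the rules — reduction scissors to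
Voronoi's K₄ cone, the shared wheel crux, and Siegel's induction step as body-vs-body

Realises card siegel-tamagawa-zeta3-reduced-bases (spine; absorbs the retired duplicates
euler-products-are-not-moves,
arithmetic-volumes-unfolding-voronoi, finite-siegel-unfolding-conical-cells and their audited
CARRY). GEOMETRY OF NUMBERS AS A
SOURCE OF TYPED CONJECTURE-1 INSTANCES: Minkowski's reduction domain for positive ternary forms (all
four sign classes),
truncated at determinant 1, is a ℚ-semialgebraic body M ⊂ ℝ⁶ (finitely many linear inequalities,
Terras2016 Thm 1.4.1(4), plus
0 < det < 1) of Lebesgue volume ζ(3)/6 (Minkowski 1905; Siegel1936/Siegel1945; Terras2016 Thm 1.4.4: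
v₃ = ζ(3)/24 per sign
class) — Siegel's covolume of SL₃(ℤ) / Tamagawa number one read at the archimedean place. X (the
decidable bet, = crux
MinkowskiTernaryAccessible): the identity "36·vol M = 6ζ(3) = P(W₃)" is a theorem of the H21 KZ
calculus, i.e. the representation
(M, integrand 36) is KZ-equivalent to the 6ζ(3)-simplex (1 > t₀ > t₁ > t₂ > 0, 6/(t₀t₁(1−t₂))) — the
SAME right-hand side as the
shared wheel item WheelThreeSpokes of route LinRedNormalForm, so that all glue is literal (36 = 6
Voronoi copies × 6 from the cone
integral; no division by integers is a rule). This is a DECISION route at one instance: the deciding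
theorem `closes` (PROVED in the route file, rev 1) shows X is
forced by the summit given Minkowski's value theorem, so a refutation of X (= a proof of the
negative-side item
NotMinkowskiTernaryAccessible) refutes KontsevichZagierPeriods, while a proof of X is
the first finite (dissection / algebraic substitution / Newton–Leibniz) proof of a Siegel–Minkowski
volume formula. Proposed
positive mechanism (two layers): reduction theory is scissors congruence inside rule (2) — [M, 6] ~
[W, 1] with W = {x ∈ ℝ⁶_{>0} :
Ψ_{K₄}(x) < 1} the K₄ spanning-tree body (= Voronoi's principal perfect cone truncated at det < 1,
Brown2023Bordifications Ex.
16.6; vol W = ζ(3)) by finitely many unimodular integer linear maps (support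
ReductionScissorsTernary); [W, 6] ~ the affine wheel
integral [ℝ₊⁵, Ψ_{K₄}(x,1)⁻²] by one change of variables and one Newton–Leibniz (support
WheelBodyToAffineChart); and the wheel
with three spokes in the rules (crux WheelThreeSpokes, shared). Third crux: Siegel's induction step
3 → 4 as an identity between
two 10-dimensional integrand-1 bodies (SiegelStepQuaternary), ζ(3) sitting inside both and ζ(4) =
π⁴/90 absorbed into two discs.
Lean: `∀ (r : Literature.NumberTheory.Transcendental.KZ.IntegralRep 6) (r' :
Literature.NumberTheory.Transcendental.KZ.IntegralRep 3), r.domain = {y : Fin 6 → ℝ | 0 < y 0 ∧ 0 <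
Matrix.det !![y 0, y 3, y 4; y 3, y 1, y 5; y 4, y 5, y 2] ∧ Matrix.det !![y 0, y 3, y 4; y 3, y 1,
y 5; y 4, y 5, y 2] < 1 ∧ ∀ (k : Fin 3) (a : Fin 3 → ℝ), (∀ j, a j = -1 ∨ a j = 0 ∨ a j = 1) → (∃ j,
k ≤ j ∧ a j ≠ 0) → ![y 0, y 1, y 2] k ≤ y 0 * a 0 ^ 2 + y 1 * a 1 ^ 2 + y 2 * a 2 ^ 2 + 2 * (y 3 * a
0 * a 1 + y 4 * a 0 * a 2 + y 5 * a 1 * a 2)} → Set.EqOn r.integrand (fun _ => 36) r.domain →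
r'.domain = {t | 1 > t 0 ∧ t 0 > t 1 ∧ t 1 > t 2 ∧ t 2 > 0} → Set.EqOn r'.integrand (fun t => 6 / (t
0 * t 1 * (1 - t 2))) r'.domain → Literature.NumberTheory.Transcendental.KZ.Equivalent r r'`

## Assembly
DECIDING THEOREM (D-0027 §2.1, refutation form), PROVED in the route file at rev 1 (route-repair
2026-08-15):
`closes : MinkowskiTernaryVolume → NotMinkowskiTernaryAccessible → ¬ KontsevichZagierPeriods` — the
contrapositive form of
"summit ∧ Minkowski's value theorem ⇒ MinkowskiTernaryAccessible". Given MinkowskiTernaryVolume, any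
r with domain M and integrand 36
is IsRational (p = 36, q = 1) with value 36·(ζ(3)/6) = 6·∑ 1/(n+1)³ (r carries its own
integrability; MeasurableSet from the proved
IntegralRep.measurableSet_domain_holds); any r′ on the simplex with integrand 6/(t₀t₁(1−t₂)) is
IsRational (p = 6, q = X₀X₁(1−X₂) ≠ 0
there) with value 6·multipleZeta [3] = 6·∑ 1/(n+1)³ by the PROVED tree facts
`Literature.NumberTheory.Transcendental.KZ.mzvRep_value_holds`
(Kontsevich's formula) and `multipleZeta_singleton_holds` (the simplex {1 > t₀ > t₁ > t₂ > 0} is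
openOrderedSimplex 3 and the integrand is
6·mzvIntegrand [3] there); the summit statement then yields KZ.Equivalent r r′, contradicting the
negative-side item. Axioms of `closes`:
propext, Classical.choice, Quot.sound; one extra import (MZVSimplexRepProofs); every fact in the
cone is proved (staffable, 0 unproved deps).
So the route literally decides the summit in the refutation direction from TWO items — Minkowski's
classical value theorem
(support MinkowskiTernaryVolume, XL to formalise) and the open negative side
NotMinkowskiTernaryAccessible (crux #5 = ¬ crux #2) — exactly as
route Neg; the `Assembly` item, restated over the named negative item (an assembly item cannot be
dropped), records the same implication
and closes by `theorem Assembly_holds : Assembly := fun hV hN => closes hV hN`.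

Rationale: WHY THIS LINE. Reduction theory turns covolumes of arithmetic groups into Lebesgue volumes of
explicit ℚ-semialgebraic sets, so the
Minkowski–Siegel–Weil volume theorems (τ(SL_n) = 1; Siegel1945 mean-value theorem; Terras2016 Thm
1.4.4; Goldfeld2006 Thm 1.6.1)
are identities between KZ-RATIONAL representations of low height, while EVERY printed proof unfolds
over an infinite set
(Minkowski's class-number asymptotics, Siegel's integral formula = sum over primitive vectors,
Eisenstein constant terms,
Terras (1.229)–(1.231)): Conjecture 1 flatly predicts finite chains nobody has (Terras2016 p. 5
still lists 'geometric
interpretations of ζ(3)' as a hoped-for use of the explicit domain). Imported areas: geometry of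
numbers / reduction theory
(Minkowski, Voronoi, Siegel — the bodies, the GL_n(ℤ)-scissors, the induction step), parametric
Feynman integration and graph
motives (BroadhurstKreimer1995, BlochEsnaultKreimer2006, Brown2009FeynmanPeriods,
Brown2021InvariantForms: P(W₃) = 6ζ(3)), and
Brown's dictionary perfect cones ↔ graph Laplacians ↔ Feynman periods (Brown2023Bordifications §1.6,
Rem. 15.2, Ex. 16.6),
which makes the positive mechanism concrete: Minkowski(3) ⟺ Wheel inside P_KZ once reduction
scissors are proved. What the
line does that the existing routes do not: it is the only KZ route on arithmetic quotients — a
rational 6-dim polynomial body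
against Apéry's simplex, with a provable rank-one rung (2π/9), two provable linking rungs (scissors;
body-to-affine-chart), one
open rung SHARED with LinRedNormalForm (the wheel, now carrying a second classical pedigree:
Minkowski's covolume) and one open
rung of a new kind (Siegel's step as equal-volume bodies); each open rung either yields new finite
proofs of classical volume
formulas or hands route Neg its first arithmetic (non-Γ, non-regularisation) witness. Constants
pinned this session three ways
(Terras closed forms × sign classes; Cholesky/radial bookkeeping reproducing the card's numeric
Leb(V₂) = ζ(2); local Monte
Carlo of the Lean-transcribed bodies: 0.2003 ± 0.0004 vs ζ(3)/6 = 0.20034, 0.03514 ± 0.00018 vs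
2π²ζ(3)/675 = 0.035152,
0.6980 ± 0.0003 vs 2π/9), plus exact checks that Ψ_{K₄} dehomogenises to LinRedNormalForm's affine
polynomial, that
Ψ_{K₄}(x₅,…,x₀) = det of the reduced K₄ Laplacian (16 trees) and that the Selling map is unimodular
(det = −1).

RANKED CRUXES. #2 MinkowskiTernaryAccessible (crux) — X itself: (M, 36) ~ (6ζ(3)-simplex), M =
Minkowski-reduced ternary Gram matrices (finite {0,±1} list, all four sign classes) with 0 < det < 1
(volume ζ(3)/6); the constant 36 = 6 × 6 puts the Minkowski side at the wheel's normalisation (the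
6ζ(3)-simplex is verbatim the right-hand side of the shared item WheelThreeSpokes), so the foreseen
glue [M,36] ~ 6·[M,6] ~ 6·[W,1] ~ [W,6] ~ [ℝ₊⁵, Ψ⁻²] ~ [Δ³, 6/(t₀t₁(1−t₂))] is subgroup arithmetic
plus transitivity (no division by integers is a rule). Card item SiegelZeta3 in form coordinates
(audit salvage: the integrand-constant cone rep is the cleaner typed side). [difficulty:
open-problem] (why it might fail: Every proof of v₃ = ζ(3)/24 (Minkowski asymptotics, Siegel's
integral formula over primitive vectors, Eisenstein/Tamagawa) is an infinite unfolding; if no finite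
chain exists an additive invariant of FormalRep separates the pair and the summit is false.)
[Siegel1945, Siegel1936, Terras2016, KontsevichZagier2001, Brown2023Bordifications,
doi:10.2307/2007881]
#3 WheelThreeSpokes (crux) — SHARED ITEM stmt-KontsevichZagierPeriods-3913 (route LinRedNormalForm,
decl WheelThreeSpokes; identical signature, so this route attaches to it at rank 3): the affine
wheel integral [ℝ₊⁵, 1/Ψ_{K₄}(x₀,…,x₄,1)²] (value P(K₄) = 6ζ(3)) is KZ-equivalent to the
6ζ(3)-simplex. In this route it is the open core of the positive mechanism and acquires a second
classical meaning: by ReductionScissorsTernary + WheelBodyToAffineChart it is equivalent inside P_KZ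
to MinkowskiTernaryAccessible (Minkowski's covolume theorem), so Siegel(3) has a finite proof
exactly when the wheel does (Brown2023Bordifications Ex. 16.6: the principal perfect cone of rank 3
is the W₃ cell, period 60ζ(3) for ω⁵). [difficulty: L] (why it might fail: All proofs of P(W₃) =
6ζ(3) (Gegenbauer x-space, HyperInt hyperlogarithms with reglim at 0/∞, graphical functions, Brown's
canonical forms) integrate Schwinger parameters out with polylogarithmic primitives; an
all-variables-kept chain with convergent rational intermediates has never been exhibited.)
[BroadhurstKreimer1995, BlochEsnaultKreimer2006, Brown2009FeynmanPeriods, Brown2021InvariantForms,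
Brown2023Bordifications, Panzer2015]
#4 SiegelStepQuaternary (crux) — Siegel's induction step Vol(S𝓜₄) = Vol(S𝓜₃)·Λ(2) (Terras2016
(1.231); Λ(2) = ζ(4)/π² = π²/90) as Hilbert's third problem between two 10-dimensional integrand-1
ℚ-semialgebraic bodies: M₄ = Minkowski-reduced positive quaternary Gram matrices (finite {0,±1}
list, all eight sign classes) with det < 1 (volume 8·π²ζ(3)/2700 = 2π²ζ(3)/675) is KZ-equivalent to
M × D × D, D the disc of radius² 2/15 (volume (ζ(3)/6)(2π/15)² = 2π²ζ(3)/675; MC 0.03514 ± 0.00018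
vs 0.035152). No zeta simplex, no transcendental rep on either side; ζ(3) sits inside both bodies.
[difficulty: open-problem] (why it might fail: The step is proved only by unfolding over the
infinite-index parabolic Γ ∩ P(1,3) (sum over primitive vectors, Terras (1.229)–(1.231)); no
fibrewise dissection of 𝓜₄ over 𝓜₃ is known, and a scissors-type invariant of semialgebraic bodies
could separate the two sides.) [Terras2016, Siegel1945, Siegel1936, KontsevichZagier2001,
CressonViusos2022]
#5 NotMinkowskiTernaryAccessible (crux) — the NEGATIVE SIDE ¬X as its own item (self-contained
signature = ¬(signature of #2); filed at route-repair rev 1 because the deciding theorem may only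
assume listed items): together with MinkowskiTernaryVolume it is the hypothesis of the proved
`closes`. A proof = an additive invariant ι : KZ.FormalRep →+ A vanishing on the four move sets with
ι([M,36] − [Δ³, 6/(t₀t₁(1−t₂))]) ≠ 0 (template Neg.NegObstructionShape,
stmt-KontsevichZagierPeriods-0313; candidates: definability classes of the data, scissors-type
invariants of ℚ-semialgebraic sets weighted by rational forms, an 'arithmetic-quotient' grading);
its negation is verbatim #2, so settling either closes both. [difficulty: open-problem] (why it
might fail: X may simply be true — scissors + K₄ chart + a wheel chain would join the pair inside
the rules — and no FormalRep invariant finer than value/Hodge data is known.) [KontsevichZagier2001,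
Brown2023Bordifications, Terras2016, Siegel1945, CressonViusos2022, HuberMullerStach2017]
#9 ReductionScissorsTernary (support) — reduction theory is scissors congruence inside rule (2): (M,
6) ~ (W, 1), W = {x ∈ ℝ⁶_{>0} : Ψ_{K₄}(x) < 1} with Ψ_{K₄} the Kirchhoff polynomial (sum over the 16
co-trees, homogenisation of LinRedNormalForm's affine polynomial). GL₃(ℤ) acts on Sym₃ ≅ ℝ⁶ by Y ↦
γᵀYγ, integer-linear with |det| = |det γ|⁴ = 1 (change of variables); Minkowski's sign-normalised
domain and Voronoi's principal cone σ(A₃) = {Σ_e λ_e v_e v_eᵀ, λ ≥ 0, v_e ∈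
{e₁,e₂,e₃,e₁−e₂,e₁−e₃,e₂−e₃}} are both exact fundamental domains up to finite stabilisers (orders 4
= diagonal signs mod ±I on M, 24 = Aut(A₃)/± on σ), equidecomposable by finitely many γ
(Selling/Voronoi reduction of ternary forms, ConwaySloane1999; Siegel finiteness); after the index
reversal λ_i = x_{5−i}, λ ↦ Y(λ) is the unimodular map y₁₁ = λ₀+λ₃+λ₄, y₂₂ = λ₁+λ₃+λ₅, y₃₃ =
λ₂+λ₄+λ₅, y₁₂ = −λ₃, y₁₃ = −λ₄, y₂₃ = −λ₅ with det Y(λ) = Ψ_{K₄}(x) (matrix-tree; checked exactly).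
Cut W along null walls into 24 stabiliser pieces, regroup into 6 × (4 sign copies of a Minkowski
fundamental body) = 6 × M; integrand additivity turns 6·[M,1] into [M,6]. Provable with effort (~400
lines of bookkeeping + an explicit finite γ-list). [difficulty: L] [Terras2016, ConwaySloane1999,
Brown2023Bordifications, doi:10.2307/2007881]
#9 WheelBodyToAffineChart (support) — (W, 6) ~ (ℝ₊⁵, Ψ_{K₄}(x₀,…,x₄,1)⁻²) — the right-hand side
verbatim the wheel side of WheelThreeSpokes. Two moves: the ℚ-semialgebraic change of variables (x′,
s) ↦ x = (s x′₀, …, s x′₄, s) on ℝ₊⁵ × ℝ₊ (Jacobian s⁵; Ψ(x) = s³Ψ(x′,1), so W becomes the band 0 <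
s < Ψ(x′,1)^{−1/3}) and one Newton–Leibniz move in s with the polynomial primitive s⁶ (∫₀^{Ψ^{−1/3}}
6s⁵ ds = Ψ⁻²). Provable now; it is the link making Minkowski(3) ⟺ Wheel literal. [difficulty:
provable-now] [Brown2021InvariantForms, BlochEsnaultKreimer2006, KontsevichZagier2001]
#9 MinkowskiBinaryAccessible (support) — rank-one calibration (card item SiegelZeta2 in form
coordinates): Minkowski's reduced binary body {|2y₁₂| ≤ y₁₁ ≤ y₂₂, 0 < det < 1} ⊂ ℝ³ (both sign
classes; volume 2π/9 = 2·v₂, Terras2016 (1.187) and Thm 1.4.4; direct integration and MC 0.6980 ±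
0.0003) with integrand 1 is KZ-equivalent to the disc x² + y² < 2/9. Paper chain (~12 moves):
Newton–Leibniz in y₂₂ (primitive y₂₂) and in y₁₂ (polynomial primitive), domain additivity at y₁₁ =
1, rational part 25/36 cancels inside an algebraic 1-dim rep on (1, 2/√3), circular-segment
dissection + a disc CoV for the π-part. Provable now; exercises every move constructor. [difficulty:
M] [Terras2016, KontsevichZagier2001]
#9 ReducedBasesDensity (support) — the card's own model (reduced bases; QR coordinates X = kU,
matrix-Lebesgue density u₁₁²u₂₂ after the SO(3) fibre) joined to Minkowski's body and its constant
PINNED: (R₃, u₁₁²u₂₂) ~ (M, 1/6), R₃ = upper-triangular U with positive diagonal whose Gram matrix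
UᵀU lies in M (value ζ(3)/36 both sides; the card's 'q = 1/48 up to stabiliser convention'
corrected: Siegel's cone volume is ζ(2)ζ(3)/3 per lattice and M carries 4 oriented reduced bases,
Leb(V₃) = 8π²·ζ(3)/36 = (4/3)ζ(2)ζ(3)). Chain: Cholesky CoV U ↦ UᵀU (polynomial, injective, Jacobian
8u₁₁³u₂₂²u₃₃) gives (M, det^{−1/2}/8); then det^{−1/2} − 1 = ∫_{det}^{1} ½t^{−3/2}dt (Newton–Leibniz
backwards), Fubini, the algebraic CoV Y = t^{1/3}Y′ (Jacobian t²) and one Newton–Leibniz in t (∫₀¹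
½t^{1/2} = 1/3) give (M, (1 + 1/3)/8) = (M, 1/6). MC this session: ∫_M det^{−1/2} = 0.2679 ± 0.0004
vs (4/3)(ζ(3)/6) = 0.2671. [difficulty: M] [Siegel1945, Terras2016, KontsevichZagier2001]
#9 MinkowskiTernaryVolume (support) — KNOWN THEOREM, unproved in Lean, hypothesis of the deciding
theorem `closes` and of the Assembly (not imported from any Literature fact; the route's import cone
is proved): the body M has Lebesgue volume ζ(3)/6 = 4 × v₃, v₃ = 2Λ(1)Λ(3/2)/4 = ζ(3)/24 (Minkowski
1905; Siegel1936; Siegel1945; Terras2016 Lemma 1.4.5 + Thm 1.4.4; the factor 4 = diagonal sign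
changes mod ±I, since M omits Minkowski's normalisation y₁₂, y₂₃ ≥ 0). A direct formalisation
(Siegel's integral formula for n = 3) is an XL but legitimate target; a move-chain proof of
MinkowskiTernaryAccessible proves it as a corollary (Equivalent.value_eq_holds + mzvRep_value_holds
+ multipleZeta_singleton_holds). If refuted as typed, the inequality list or the constant was
mis-transcribed (MC this session: 0.2003 ± 0.0004) — restate, not a kill. [difficulty: XL]
[Siegel1945, Siegel1936, Terras2016]

TWO-LAYER PLAN. Foreseen glued splits (nothing filed now): MinkowskiTernaryAccessible ⇐
ReductionScissorsTernary → WheelBodyToAffineChart →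
WheelThreeSpokes → MinkowskiTernaryAccessible (glue = subgroup arithmetic + KZ.Equivalent.trans, k =
3: [M,36] ~ 6·[M,6] ~ 6·[W,1] ~
[W,6] ~ [ℝ₊⁵,Ψ⁻²] ~ [Δ³, 6/(t₀t₁(1−t₂))]). WheelThreeSpokes is decomposed by its owner route
LinRedNormalForm (unfolded HyperInt trace
with convergent rational pairings). SiegelStepQuaternary ⇐ either (a) a direct fibrewise dissection
of M₄ over its ternary corner
(the finite shadow of Terras (1.230)), or (b) Minkowski(4)Accessible ([M₄, const] ~ [ζ(2)-rep ×
6ζ(3)-simplex]) +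
MinkowskiTernaryAccessible + Euler's ζ(4) = π⁴/90 chain (Beukers–Kolk–Calabi style) + product
bookkeeping (KZProduct.lean). Further
rungs only after a crux closes: Minkowski(5) / the Siegel–Voronoi identity over the three perfect
cones of rank 5
(Brown2023Bordifications §1.6 via [BS21]: ζ(3,5) must cancel), the literal matrix body V₃ via an
SO(3)-fibre lemma (Cayley
parametrisation; ball reps), and the SL_n ladder.

KILL CRITERIA. Refutation of MinkowskiTernaryAccessible = proof of item #5
NotMinkowskiTernaryAccessible (an additive invariant ι : FormalRep →+ A vanishing on the four move
sets with ι([M,36] −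
[6ζ(3)-simplex]) ≠ 0, template Neg.NegObstructionShape) ⇒ the proved `closes` fires: with
MinkowskiTernaryVolume the summit is refuted — hand
the witness to route Neg and close this route `refuted:MinkowskiTernaryAccessible` with that census.
Refutation of WheelThreeSpokes
after ReductionScissorsTernary and WheelBodyToAffineChart are proved ⇒ same (the two cruxes are then
equivalent). PROOF of
MinkowskiTernaryAccessible ⇒ item #5 is refuted and the route goes BROKEN by design (its deciding
hypothesis is dead): close `superseded` with census 'first finite proof of a
Siegel–Minkowski covolume' and reopen on the SL_n ladder (n = 4, 5) as a new route. Refutation of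
ReductionScissorsTernary,
WheelBodyToAffineChart, MinkowskiBinaryAccessible, ReducedBasesDensity or MinkowskiTernaryVolume AS
TYPED can only be a transcription
slip (inequality list / constant; all checked numerically or exactly here) ⇒ restate 1:1, not a
kill. SiegelStepQuaternary
refuted ⇒ informally also ¬summit (it is an instance given Minkowski's n = 3, 4 values and ζ(4) =
π⁴/90); escalate to Neg.

NOT DECOMPOSED YET. The explicit finite γ-list and stabiliser sub-cone for ReductionScissorsTernary
(Selling/Voronoi reduction of ternary forms; a
prover's bookkeeping); the internal structure of the wheel chain (owned by route LinRedNormalForm;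
we file only the two links to
it); the SO(3)-fibre lemma to the card's literal 9-dim matrix body V₃ (only the triangular part
ReducedBasesDensity is filed); the
card's exploratory VoronoiStokes (cell-by-cell Stokes on the well-rounded retract / Borel–Serre
boundary) — kept as the fallback
positive mechanism if the wheel resists; n = 5 (three perfect cones, ζ(3)ζ(5)/270 all-signs body;
Minkowski's finite list needs
entries up to ±2 there) and the general SL_n ladder; the even/symplectic siblings (Sp₄, Hilbert
modular: card
gauss-bonnet-transgression-is-a-chain) and the Bianchi rank-one rung (card
bianchi-covolumes-pi-free-humbert, route HyperbolicBloch)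
— other routes. The card's crux (5) 'Sp₄ control' is dropped (triage: π-powers in the value do not
make the source domain easier).

CHEAPEST FALSIFIER. (i) Exact rational-arithmetic checks a refuter can rerun in minutes (all done
here, all pass): the map λ ↦ Y(λ) is unimodular (det =
−1) and det Y(λ) = Ψ_{K₄}(x₅,…,x₀) (16 trees); Ψ_{K₄}(x, x₅ = 1) is LinRedNormalForm's affine
polynomial; |Stab| = 24 on σ(A₃), 4 sign
classes on M ⇒ vol W = 6·vol M; v₃ = 2Λ(1)Λ(3/2)/4 = ζ(3)/24, v₄ = π²ζ(3)/2700 (Terras Thm 1.4.4) ⇒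
both sides of
SiegelStepQuaternary equal 2π²ζ(3)/675. Monte Carlo of the Lean-transcribed bodies: vol M = 0.2003 ±
0.0004, vol M₄ = 0.03514 ±
0.00018, binary 0.6980 ± 0.0003, ∫_M det^{−1/2} = 0.2679 ± 0.0004 — all within 2σ of the closed
forms; a kit cubature to 6 digits
would upgrade this. (ii) Literature: a finite/elementary derivation of v₃ = ζ(3)/24 or of
vol(SL₃(ℝ)/SL₃(ℤ)) in print would make
the rank-2 crux 'known' — searched (crossref, zbMATH, galaxy pdf/panama, Terras2016 full text, Brown
2023 full text): none; Terras
p. 5 lists 'geometric interpretations of ζ(3)' as open. (iii) The negative side has no cheap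
falsifier: it needs the FormalRep
invariant nobody has.

NUMBERS. Per sign class (Terras2016 Thm 1.4.4, v_n = 2∏_{k=2}^n Λ(k/2)/(n+1), Λ(s) =
π^{−s}Γ(s)ζ(2s)): v₂ = π/9, v₃ = ζ(3)/24, v₄ = π²ζ(3)/2700,
v₅ = ζ(3)ζ(5)/4320; all-sign-class bodies (× 2^{n−1}): 2π/9, ζ(3)/6 = 0.200343, 2π²ζ(3)/675 =
0.035152, ζ(3)ζ(5)/270. Siegel: cone
volume of {covol < 1} lattices = ζ(2)⋯ζ(n)/n; Leb(V₂) = ζ(2) (card numeric), Leb(V₃) =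
(4/3)ζ(2)ζ(3); ∫_{R₃} u₁₁²u₂₂ = ζ(3)/36.
Wheel: P(K₄) = 6ζ(3), I_{W₃}(ω⁵) = 60ζ(3) (Brown2021InvariantForms), vol W = ζ(3), 36·vol M = 6ζ(3);
stabilisers 4 and 24; disc
radius² 2/15. Items at open: 9 (3 cruxes — one shared —, 5 support, 1 assembly); after route-repair
rev 1: 10 items (4 cruxes — one shared —, 5 support, 1 assembly restated over the named negative
item) + the PROVED deciding theorem `closes : MinkowskiTernaryVolume → NotMinkowskiTernaryAccessible
→ ¬ KontsevichZagierPeriods` (refutation form).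

DEFINITION REQUESTS. After open: `minkowskiReduced (n : ℕ) : Set (Matrix (Fin n) (Fin n) ℝ)`
(Terras2016 (1.185)) with the named facts 'finite {0,±1}
list for n ≤ 4' (Thm 1.4.1(4)) and 'Euclidean volume of {det ≤ 1} = 2∏Λ(k/2)/(n+1)' (Thm 1.4.4) in a
new topic
Literature/NumberTheory/GeometryOfNumbers — lets the n = 4, 5 rungs and MinkowskiTernaryVolume be
restated over library notions;
`kirchhoffPolynomial` / perfect cones are not requested (the explicit K₄ polynomial suffices and is
shared with LinRedNormalForm).

Novelty: Searches (2026-08-15): `lit search --hybrid "Minkowski reduction domain volume ternary … zeta(3) …"`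
(held: Terras2016 — READ pp. 5,
147, 159–162, 173, 189–194, 344; Siegel's Lectures on the Geometry of Numbers; Borel–Godement–Siegel
reduction theory; Cassels;
Conway–Sloane); `lit search --source crossref "volume fundamental domain SL(3,Z) Minkowski reduced
ternary forms zeta(3)"` (15 rows:
Mahler 1940 doi:10.1112/jlms/s1-15.3.193, Gordon–Grenier–Terras doi:10.2307/2007881,
Shintani/Epstein zeta items — no finite volume
derivation); `--source zbmath "Minkowski fundamental domain volume zeta"` (2: Terras 1988, Hlawka
1952); arXiv API rate-limited (429)
all session; `lit galaxy search --star all` ×3 (0 substring hits) and `--star pdf --mode bm25` on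
'elementary proof of Minkowski–Siegel
volume formula' (12 rows, none relevant); `lit frontier KontsevichZagierPeriods --since 2020` (30
rows: MZV, odd-zeta irrationality, Nori
motives — no geometry of numbers) and `lit bridges --cross any`; Brown arXiv:2309.12753 READ pp. 1,
6, 61, 69; `ledger negatives` (empty);
the 123 cards of the sub and the 31 route files (grep Minkowski|Siegel|Voronoi|covolume: none
outside this spine's cluster; the wheel is
LinRedNormalForm's stmt-3913 and PhiFourLaboratory's calibration).
Nearest prior art found: Brown2023Bordifications (§1.6 'volumes of cographical cells in the perfect
cone decomposition are Feynman
integrals'; Rem. 15.2 Minkowski/[Sie36]; Ex. 16.6: for g = 3 the fundamental class is the wh  [refs: 10.1112/jlms/s1-15.3.193, 10.2307/2007881, 2309.12753, doi:10.1112/jlms/s1-15.3.193, doi:10.2307/2007881, Terras2016, Siegel1945, Siegel1936, KontsevichZagier2001, CressonViusos2022]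

Barriers (technique_class: reduction-scissors, perfect-cone-feynman, covolume-test): - technique_class: reduction-scissors, perfect-cone-feynman, covolume-test
- Literature.Barriers.KontsevichZagierPeriods.noSemialgebraicPrimitive_inv_sub_two: respected and
partly evaded — ReductionScissorsTernary uses no Newton–Leibniz at all (linear maps + cuts);
WheelBodyToAffineChart, ReducedBasesDensity and MinkowskiBinaryAccessible use only algebraic
primitives (s⁶, t^{1/2}, polynomials, circle CoV); the barrier bites exactly on the shared crux
WheelThreeSpokes (Schwinger parameters integrated out by hyperlogarithms in every known proof),
where the bet is LinRedNormalForm's unfolded chain — tested, not evaded.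
- Literature.Barriers.KontsevichZagierPeriods.cressonViuSos_prop_3_2: crux 4 is literally a
same-dimension equal-volume statement about two ℚ-semialgebraic bodies, the setting of the
Hauptvermutung obstruction; evaded because no global (semialgebraic or PL) homeomorphism M₄ ≅ M × D
× D is claimed — chains are finite dissections with algebraic pieces and Newton–Leibniz lifts
through extra variables; the scissors support is a finite dissection by construction.
- Literature.Barriers.KontsevichZagierPeriods.kzConjecture_implies_oddZetaAlgIndep: this is the
sector where it lives (ζ(3), later ζ(3)ζ(5)) and it is respected: every filed identity is between
representations already KNOWN equal (Minkowski–Siegel, Broadhurst–Kreimer); no independence of odd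
zeta values is claimed or needed; a proof of the cruxes re-proves known equalities finitely, a
refutation refutes the su

History (route lifecycle, newest last):
- 2026-08-15T16:23:01Z · rev 1: restated Assembly (stmt-KontsevichZagierPeriods-4422) — route-repair(glue, D-0027): filed the negative side NotMinkowskiTernaryAccessible (crux, rank 5; self-contained signature = ¬ MinkowskiTernaryAccessible) flagge (planner-rbadge-KontsevichZagierPeriods-SiegelT-b31b66e2-g2-0)
- 2026-08-23T16:14:00Z · DORMANT — reconciler: no traction for 6.1 d (last activity item-proof-filed at 2026-08-17T12:55:35Z); parked, not closed — `ledger route dormant route-KontsevichZagierPer (operator:999:1351109)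

sub-problem: KontsevichZagierPeriods · status: dormant · opened planner-plancard-KontsevichZagierPeriods-Kont-9cf6d9de-0 2026-08-15T11:33:40Z · rev 2 · ledger route-KontsevichZagierPeriods-SiegelTamagawa
GENERATED by the gate from the ledger (D-0016/17). Provers cite these decls: `theorem foo : Summit.KontsevichZagierPeriods.KontsevichZagierPeriods.Theses.SiegelTamagawa.<Decl> := …` in Summits/KontsevichZagierPeriods/KontsevichZagierPeriods/Theorems/<Name>.lean.
-/

namespace Summit.KontsevichZagierPeriods.KontsevichZagierPeriods.Theses.SiegelTamagawa

open scoped BigOperators Topology Manifold Classical MeasureTheory ProbabilityTheory Matrix InnerProductSpace ComplexConjugate ContinuousMap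
open Filter Set Function TopologicalSpace MeasureTheory

attribute [summit_statement] _root_.KontsevichZagierPeriods

open Literature Periods

/-- item stmt-KontsevichZagierPeriods-4415 · crux · rank 2 · open · by planner
why it might fail: Every proof of v₃ = ζ(3)/24 (Minkowski asymptotics, Siegel's integral formula over primitive vectors, Eisenstein/Tamagawa) is an infinite unfolding; if no finite chain exists an additive invariant of FormalRep separates the pair and the summit is false.
sources: Siegel1945, Siegel1936, Terras2016, KontsevichZagier2001, Brown2023Bordifications, doi:10.2307/2007881
[crux] X itself: (M, 36) ~ (6ζ(3)-simplex), M = Minkowski-reduced ternary Gram matrices (finite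
{0,±1} list, all four sign classes) with 0 < det < 1 (volume ζ(3)/6); the constant 36 = 6 × 6 puts
the Minkowski side at the wheel's normalisation (the 6ζ(3)-simplex is verbatim the right-hand side
of the shared item WheelThreeSpokes), so the foreseen glue [M,36] ~ 6·[M,6] ~ 6·[W,1] ~ [W,6] ~
[ℝ₊⁵, Ψ⁻²] ~ [Δ³, 6/(t₀t₁(1−t₂))] is subgroup arithmetic plus transitivity (no division by integers
is a rule). Card item SiegelZeta3 in form coordinates (audit salvage: the integrand-constant cone
rep is the cleaner typed side). [difficulty: open-problem] -/
@[route_item "route-KontsevichZagierPeriods-SiegelTamagawa"]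
def MinkowskiTernaryAccessible : Prop :=
  ∀ (r : Literature.NumberTheory.Transcendental.KZ.IntegralRep 6) (r' : Literature.NumberTheory.Transcendental.KZ.IntegralRep 3), r.domain = {y : Fin 6 → ℝ | 0 < y 0 ∧ 0 < Matrix.det !![y 0, y 3, y 4; y 3, y 1, y 5; y 4, y 5, y 2] ∧ Matrix.det !![y 0, y 3, y 4; y 3, y 1, y 5; y 4, y 5, y 2] < 1 ∧ ∀ (k : Fin 3) (a : Fin 3 → ℝ), (∀ j, a j = -1 ∨ a j = 0 ∨ a j = 1) → (∃ j, k ≤ j ∧ a j ≠ 0) → ![y 0, y 1, y 2] k ≤ y 0 * a 0 ^ 2 + y 1 * a 1 ^ 2 + y 2 * a 2 ^ 2 + 2 * (y 3 * a 0 * a 1 + y 4 * a 0 * a 2 + y 5 * a 1 * a 2)} → Set.EqOn r.integrand (fun _ => 36) r.domain → r'.domain = {t | 1 > t 0 ∧ t 0 > t 1 ∧ t 1 > t 2 ∧ t 2 > 0} → Set.EqOn r'.integrand (fun t => 6 / (t 0 * t 1 * (1 - t 2))) r'.domain → Literature.NumberTheory.Transcendental.KZ.Equivalent r r'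

/-- item stmt-KontsevichZagierPeriods-3913 · crux · rank 3 · closed · proved by Summit.KontsevichZagierPeriods.LinRedNormalForm.WheelThreeSpokes.WheelThreeSpokes_of_siegelTamagawa @ 37e3c03861e1 (prover) · by planner
why it might fail: All proofs of P(W₃) = 6ζ(3) (Gegenbauer x-space, HyperInt hyperlogarithms with reglim at 0/∞, graphical functions, Brown's canonical forms) integrate Schwinger parameters out with polylogarithmic primitives; an all-variables-kept chain with convergent rational intermediates has never been exhibited.
sources: BroadhurstKreimer1995, BlochEsnaultKreimer2006, Brown2009FeynmanPeriods, Brown2021InvariantForms, Brown2023Bordifications, Panzer2015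
[crux] THE FIRST FEYNMAN PERIOD INSIDE CONJECTURE 1. The wheel with three spokes K₄ (6 edges
e₁₂,e₁₃,e₁₄,e₂₃,e₂₄,e₃₄ ↔ x0,…,x4 and α₃₄ = 1 in the affine chart; Ψ = Kirchhoff polynomial = sum
over the 16 spanning-tree complements = all 3-subsets of edges except the 4 vertex stars): the
rational rep [ℝ₊⁵, 1/Ψ(x0,…,x4,1)²] (absolutely convergent: K₄ is primitive log-divergent; value
P(K₄) = 6ζ(3), BroadhurstKreimer1995, Schnetz2010 census P₃, lit:book:marcolli2009-feynman-motives
p129 'wheels give ζ(2n−3)'; the wheel motive BlochEsnaultKreimer2006) is KZ-equivalent to the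
rational simplex rep [1>t₀>t₁>t₂>0, 6/(t₀t₁(1−t₂))] (= 6·KZ.mzvRep [3] up to the rational factor).
K₄ is linearly reducible (vertex width 3: Brown2009FeynmanPeriods; HyperInt evaluates it:
Panzer2015) but NOT of dihedral shape — it probes the envelope beyond the typed core. A move chain
must (i) compactify ℝ₊⁵ by x ↦ x/(1−x) (rule 2, injective semialgebraic), (ii) run the unfolded
reduction in a linearly reducible order of the Schwinger variables, (iii) replace every regularised
limit at 0/∞ by a paired convergent rational rep, possibly after sector decomposition (blow-ups xᵢ =
yᵢyⱼ on cells = rule 2 + rule 1a). Nume -/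
@[route_item "route-KontsevichZagierPeriods-SiegelTamagawa"]
def WheelThreeSpokes : Prop :=
  ∀ (r : Literature.NumberTheory.Transcendental.KZ.IntegralRep 5) (r' : Literature.NumberTheory.Transcendental.KZ.IntegralRep 3), r.domain = {x | ∀ i, 0 < x i} → Set.EqOn r.integrand (fun x => 1 / (x 0 * x 1 * x 3 + x 0 * x 1 * x 4 + x 0 * x 1 + x 0 * x 2 * x 3 + x 0 * x 2 * x 4 + x 0 * x 2 + x 0 * x 3 + x 0 * x 4 + x 1 * x 2 * x 3 + x 1 * x 2 * x 4 + x 1 * x 2 + x 1 * x 3 * x 4 + x 1 * x 4 + x 2 * x 3 * x 4 + x 2 * x 3 + x 3 * x 4) ^ 2) r.domain → r'.domain = {t | 1 > t 0 ∧ t 0 > t 1 ∧ t 1 > t 2 ∧ t 2 > 0} → Set.EqOn r'.integrand (fun t => 6 / (t 0 * t 1 * (1 - t 2))) r'.domain → Literature.NumberTheory.Transcendental.KZ.Equivalent r r'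

/-- item stmt-KontsevichZagierPeriods-4416 · crux · rank 4 · open · by planner
why it might fail: The step is proved only by unfolding over the infinite-index parabolic Γ ∩ P(1,3) (sum over primitive vectors, Terras (1.229)–(1.231)); no fibrewise dissection of 𝓜₄ over 𝓜₃ is known, and a scissors-type invariant of semialgebraic bodies could separate the two sides.
sources: Terras2016, Siegel1945, Siegel1936, KontsevichZagier2001, CressonViusos2022
[crux] Siegel's induction step Vol(S𝓜₄) = Vol(S𝓜₃)·Λ(2) (Terras2016 (1.231); Λ(2) = ζ(4)/π² = π²/90)
as Hilbert's third problem between two 10-dimensional integrand-1 ℚ-semialgebraic bodies: M₄ =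
Minkowski-reduced positive quaternary Gram matrices (finite {0,±1} list, all eight sign classes)
with det < 1 (volume 8·π²ζ(3)/2700 = 2π²ζ(3)/675) is KZ-equivalent to M × D × D, D the disc of
radius² 2/15 (volume (ζ(3)/6)(2π/15)² = 2π²ζ(3)/675; MC 0.03514 ± 0.00018 vs 0.035152). No zeta
simplex, no transcendental rep on either side; ζ(3) sits inside both bodies. [difficulty:
open-problem] -/
@[route_item "route-KontsevichZagierPeriods-SiegelTamagawa"]
def SiegelStepQuaternary : Prop :=
  ∀ (r r' : Literature.NumberTheory.Transcendental.KZ.IntegralRep 10), r.domain = {z : Fin 10 → ℝ | (!![z 0, z 4, z 5, z 6; z 4, z 1, z 7, z 8; z 5, z 7, z 2, z 9; z 6, z 8, z 9, z 3] : Matrix (Fin 4) (Fin 4) ℝ).PosDef ∧ Matrix.det !![z 0, z 4, z 5, z 6; z 4, z 1, z 7, z 8; z 5, z 7, z 2, z 9; z 6, z 8, z 9, z 3] < 1 ∧ ∀ (k : Fin 4) (a : Fin 4 → ℝ), (∀ j, a j = -1 ∨ a j = 0 ∨ a j = 1) → (∃ j, k ≤ j ∧ a j ≠ 0) → ![z 0,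 z 1, z 2, z 3] k ≤ z 0 * a 0 ^ 2 + z 1 * a 1 ^ 2 + z 2 * a 2 ^ 2 + z 3 * a 3 ^ 2 + 2 * (z 4 * a 0 * a 1 + z 5 * a 0 * a 2 + z 6 * a 0 * a 3 + z 7 * a 1 * a 2 + z 8 * a 1 * a 3 + z 9 * a 2 * a 3)} → Set.EqOn r.integrand (fun _ => 1) r.domain → r'.domain = {z : Fin 10 → ℝ | (0 < z 0 ∧ 0 < Matrix.det !![z 0, z 3, z 4; z 3, z 1, z 5; z 4, z 5, z 2] ∧ Matrix.det !![z 0, z 3, z 4; z 3, z 1, z 5; z 4, z 5, z 2] < 1 ∧ ∀ (k : Fin 3) (a : Fin 3 → ℝ), (∀ j, a j = -1 ∨ a j = 0 ∨ a j = 1) → (∃ j, k ≤ j ∧ a j ≠ 0) → ![z 0, z 1, z 2] k ≤ z 0 * a 0 ^ 2 + z 1 * a 1 ^ 2 + z 2 * a 2 ^ 2 + 2 * (z 3 * a 0 * a 1 + z 4 * a 0 * a 2 + z 5 * a 1 * a 2)) ∧ z 6 ^ 2 + z 7 ^ 2 < 2 / 15 ∧ z 8 ^ 2 + z 9 ^ 2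 < 2 / 15} → Set.EqOn r'.integrand (fun _ => 1) r'.domain → Literature.NumberTheory.Transcendental.KZ.Equivalent r r'

/-- item stmt-KontsevichZagierPeriods-10747 · crux · rank 5 · open · by planner
why it might fail: X may simply be true: scissors + K4 chart + a wheel chain (Brown2023 Ex. 16.6; LinRedNormalForm) would join the pair in the rules; and a proof needs an additive FormalRep invariant killing all four move sets yet separating equal-valued rational reps; none finer than Hodge data is known.
sources: KontsevichZagier2001, Brown2023Bordifications, Terras2016, Siegel1945, CressonViusos2022, HuberMullerStach2017
[crux] NEGATIVE SIDE of the rank-2 crux MinkowskiTernaryAccessible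
(stmt-KontsevichZagierPeriods-4415), filed as its own item (D-0027 route-repair 2026-08-15): the
Minkowski ternary instance of Conjecture 1 is NOT accessible, i.e. no finite chain of KZ moves joins
(M, 36), M = Minkowski-reduced ternary Gram body (finite {0,±1} list, all four sign classes, 0 < det
< 1; Lebesgue volume ζ(3)/6, Minkowski 1905 / Siegel1945 / Terras2016 Thm 1.4.4), to the
6ζ(3)-simplex (1 > t0 > t1 > t2 > 0, 6/(t0 t1 (1 - t2))). LOAD-BEARING for the deciding theorem,
which is now PROVED in the route file: `closes : MinkowskiTernaryVolume →
NotMinkowskiTernaryAccessible → ¬ KontsevichZagierPeriods` (both reps have KZ's literal rational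
shape, p/q = 36/1 and 6/(X0 X1 (1 - X2)); r.value = 36 vol M = 6 Σ 1/(n+1)^3 by the volume item;
r'.value = 6 ∫_Δ ω0 ω0 ω1 = 6 ζ(3) by the proved tree facts KZ.mzvRep_value_holds +
multipleZeta_singleton_holds; the summit statement would then give KZ.Equivalent r r') — this
replaces the dropped `Assembly` item, whose content it is. A proof of THIS item must exhibit an
additive invariant ι : KZ.FormalRep →+ A vanishing on the four move sets (domain/integrand
additivity, ℚ-s -/
@[route_item "route-KontsevichZagierPeriods-SiegelTamagawa", crux]
def NotMinkowskiTernaryAccessible : Prop :=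
  ¬ (∀ (r : Literature.NumberTheory.Transcendental.KZ.IntegralRep 6) (r' : Literature.NumberTheory.Transcendental.KZ.IntegralRep 3), r.domain = {y : Fin 6 → ℝ | 0 < y 0 ∧ 0 < Matrix.det !![y 0, y 3, y 4; y 3, y 1, y 5; y 4, y 5, y 2] ∧ Matrix.det !![y 0, y 3, y 4; y 3, y 1, y 5; y 4, y 5, y 2] < 1 ∧ ∀ (k : Fin 3) (a : Fin 3 → ℝ), (∀ j, a j = -1 ∨ a j = 0 ∨ a j = 1) → (∃ j, k ≤ j ∧ a j ≠ 0) → ![y 0, y 1, y 2] k ≤ y 0 * a 0 ^ 2 + y 1 * a 1 ^ 2 + y 2 * a 2 ^ 2 + 2 * (y 3 * a 0 * a 1 + y 4 * a 0 * a 2 + y 5 * a 1 * a 2)} → Set.EqOn r.integrand (fun _ => 36) r.domain → r'.domain = {t | 1 > t 0 ∧ t 0 > t 1 ∧ t 1 > t 2 ∧ t 2 > 0} → Set.EqOn r'.integrand (fun t => 6 / (t 0 * t 1 * (1 - t 2))) r'.domain → Literature.NumberTheory.Transcendental.KZ.Equivalent r r')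

/-- item stmt-KontsevichZagierPeriods-4417 · support · rank 9 · open · by planner
sources: Terras2016, ConwaySloane1999, Brown2023Bordifications, doi:10.2307/2007881
[support] reduction theory is scissors congruence inside rule (2): (M, 6) ~ (W, 1), W = {x ∈ ℝ⁶_{>0}
: Ψ_{K₄}(x) < 1} with Ψ_{K₄} the Kirchhoff polynomial (sum over the 16 co-trees, homogenisation of
LinRedNormalForm's affine polynomial). GL₃(ℤ) acts on Sym₃ ≅ ℝ⁶ by Y ↦ γᵀYγ, integer-linear with
|det| = |det γ|⁴ = 1 (change of variables); Minkowski's sign-normalised domain and Voronoi's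
principal cone σ(A₃) = {Σ_e λ_e v_e v_eᵀ, λ ≥ 0, v_e ∈ {e₁,e₂,e₃,e₁−e₂,e₁−e₃,e₂−e₃}} are both exact
fundamental domains up to finite stabilisers (orders 4 = diagonal signs mod ±I on M, 24 = Aut(A₃)/±
on σ), equidecomposable by finitely many γ (Selling/Voronoi reduction of ternary forms,
ConwaySloane1999; Siegel finiteness); after the index reversal λ_i = x_{5−i}, λ ↦ Y(λ) is the
unimodular map y₁₁ = λ₀+λ₃+λ₄, y₂₂ = λ₁+λ₃+λ₅, y₃₃ = λ₂+λ₄+λ₅, y₁₂ = −λ₃, y₁₃ = −λ₄, y₂₃ = −λ₅ with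
det Y(λ) = Ψ_{K₄}(x) (matrix-tree; checked exactly). Cut W along null walls into 24 stabiliser
pieces, regroup into 6 × (4 sign copies of a Minkowski fundamental body) = 6 × M; integrand
additivity turns 6·[M,1] into [M,6]. Provable with effort (~400 lines of bookkeeping + an explicit
finite γ-list). [difficulty: L] -/
@[route_item "route-KontsevichZagierPeriods-SiegelTamagawa"]
def ReductionScissorsTernary : Prop :=
  ∀ (r r' : Literature.NumberTheory.Transcendental.KZ.IntegralRep 6), r.domain = {y : Fin 6 → ℝ | 0 < y 0 ∧ 0 < Matrix.det !![y 0, y 3, y 4; y 3, y 1, y 5; y 4, y 5, y 2] ∧ Matrix.det !![y 0, y 3, y 4; y 3, y 1, y 5; y 4, y 5, y 2] < 1 ∧ ∀ (k : Fin 3) (a : Fin 3 → ℝ), (∀ j, a j = -1 ∨ a j = 0 ∨ a j = 1) → (∃ j, k ≤ j ∧ a j ≠ 0) → ![y 0, y 1, y 2] k ≤ y 0 * a 0 ^ 2 + y 1 * a 1 ^ 2 + y 2 * a 2 ^ 2 + 2 * (y 3 * a 0 * a 1 + y 4 * a 0 * a 2 + y 5 * a 1 * a 2)} → Set.EqOn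 r.integrand (fun _ => 6) r.domain → r'.domain = {x : Fin 6 → ℝ | (∀ i, 0 < x i) ∧ x 0 * x 1 * x 3 + x 0 * x 1 * x 4 + x 0 * x 1 * x 5 + x 0 * x 2 * x 3 + x 0 * x 2 * x 4 + x 0 * x 2 * x 5 + x 0 * x 3 * x 5 + x 0 * x 4 * x 5 + x 1 * x 2 * x 3 + x 1 * x 2 * x 4 + x 1 * x 2 * x 5 + x 1 * x 3 * x 4 + x 1 * x 4 * x 5 + x 2 * x 3 * x 4 + x 2 * x 3 * x 5 + x 3 * x 4 * x 5 < 1} → Set.EqOn r'.integrand (fun _ => 1) r'.domain → Literature.NumberTheory.Transcendental.KZ.Equivalent r r'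

/-- item stmt-KontsevichZagierPeriods-4418 · support · rank 9 · closed · proved by Summit.KontsevichZagierPeriods.SiegelTamagawa.wheelBodyToAffineChart_proof @ 129140dd6827 (prover) · by planner
sources: Brown2021InvariantForms, BlochEsnaultKreimer2006, KontsevichZagier2001
[support] (W, 6) ~ (ℝ₊⁵, Ψ_{K₄}(x₀,…,x₄,1)⁻²) — the right-hand side verbatim the wheel side of
WheelThreeSpokes. Two moves: the ℚ-semialgebraic change of variables (x′, s) ↦ x = (s x′₀, …, s x′₄,
s) on ℝ₊⁵ × ℝ₊ (Jacobian s⁵; Ψ(x) = s³Ψ(x′,1), so W becomes the band 0 < s < Ψ(x′,1)^{−1/3}) and one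
Newton–Leibniz move in s with the polynomial primitive s⁶ (∫₀^{Ψ^{−1/3}} 6s⁵ ds = Ψ⁻²). Provable
now; it is the link making Minkowski(3) ⟺ Wheel literal. [difficulty: provable-now] -/
@[route_item "route-KontsevichZagierPeriods-SiegelTamagawa"]
def WheelBodyToAffineChart : Prop :=
  ∀ (r : Literature.NumberTheory.Transcendental.KZ.IntegralRep 6) (r' : Literature.NumberTheory.Transcendental.KZ.IntegralRep 5), r.domain = {x : Fin 6 → ℝ | (∀ i, 0 < x i) ∧ x 0 * x 1 * x 3 + x 0 * x 1 * x 4 + x 0 * x 1 * x 5 + x 0 * x 2 * x 3 + x 0 * x 2 * x 4 + x 0 * x 2 * x 5 + x 0 * x 3 * x 5 + x 0 * x 4 * x 5 + x 1 * x 2 * x 3 + x 1 * x 2 * x 4 + x 1 * x 2 * x 5 + x 1 * x 3 * x 4 + x 1 * x 4 * x 5 + x 2 * x 3 * x 4 + x 2 * x 3 * x 5 + x 3 * x 4 * x 5 < 1} → Set.EqOn r.integrand (fun _ => 6) r.domain → r'.domain = {x | ∀ i, 0 < x i} → Set.EqOn r'.integrand (fun x => 1 / (x 0 * x 1 * x 3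 + x 0 * x 1 * x 4 + x 0 * x 1 + x 0 * x 2 * x 3 + x 0 * x 2 * x 4 + x 0 * x 2 + x 0 * x 3 + x 0 * x 4 + x 1 * x 2 * x 3 + x 1 * x 2 * x 4 + x 1 * x 2 + x 1 * x 3 * x 4 + x 1 * x 4 + x 2 * x 3 * x 4 + x 2 * x 3 + x 3 * x 4) ^ 2) r'.domain → Literature.NumberTheory.Transcendental.KZ.Equivalent r r'

/-- item stmt-KontsevichZagierPeriods-4419 · support · rank 9 · closed · proved by Summit.KontsevichZagierPeriods.SiegelTamagawa.minkowskiBinaryAccessible_proof @ 8db109fe4555 (prover) · by planner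
sources: Terras2016, KontsevichZagier2001
[support] rank-one calibration (card item SiegelZeta2 in form coordinates): Minkowski's reduced
binary body {|2y₁₂| ≤ y₁₁ ≤ y₂₂, 0 < det < 1} ⊂ ℝ³ (both sign classes; volume 2π/9 = 2·v₂,
Terras2016 (1.187) and Thm 1.4.4; direct integration and MC 0.6980 ± 0.0003) with integrand 1 is
KZ-equivalent to the disc x² + y² < 2/9. Paper chain (~12 moves): Newton–Leibniz in y₂₂ (primitive
y₂₂) and in y₁₂ (polynomial primitive), domain additivity at y₁₁ = 1, rational part 25/36 cancels
inside an algebraic 1-dim rep on (1, 2/√3), circular-segment dissection + a disc CoV for the π-part.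
Provable now; exercises every move constructor. [difficulty: M] -/
@[route_item "route-KontsevichZagierPeriods-SiegelTamagawa"]
def MinkowskiBinaryAccessible : Prop :=
  ∀ (r : Literature.NumberTheory.Transcendental.KZ.IntegralRep 3) (r' : Literature.NumberTheory.Transcendental.KZ.IntegralRep 2), r.domain = {y : Fin 3 → ℝ | 2 * |y 2| ≤ y 0 ∧ y 0 ≤ y 1 ∧ 0 < y 0 * y 1 - y 2 ^ 2 ∧ y 0 * y 1 - y 2 ^ 2 < 1} → Set.EqOn r.integrand (fun _ => 1) r.domain → r'.domain = {x : Fin 2 → ℝ | x 0 ^ 2 + x 1 ^ 2 < 2 / 9} → Set.EqOn r'.integrand (fun _ => 1) r'.domain → Literature.NumberTheory.Transcendental.KZ.Equivalent r r'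

/-- item stmt-KontsevichZagierPeriods-4420 · support · rank 9 · open · by planner
sources: Siegel1945, Terras2016, KontsevichZagier2001
[support] the card's own model (reduced bases; QR coordinates X = kU, matrix-Lebesgue density
u₁₁²u₂₂ after the SO(3) fibre) joined to Minkowski's body and its constant PINNED: (R₃, u₁₁²u₂₂) ~
(M, 1/6), R₃ = upper-triangular U with positive diagonal whose Gram matrix UᵀU lies in M (value
ζ(3)/36 both sides; the card's 'q = 1/48 up to stabiliser convention' corrected: Siegel's cone
volume is ζ(2)ζ(3)/3 per lattice and M carries 4 oriented reduced bases, Leb(V₃) = 8π²·ζ(3)/36 =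
(4/3)ζ(2)ζ(3)). Chain: Cholesky CoV U ↦ UᵀU (polynomial, injective, Jacobian 8u₁₁³u₂₂²u₃₃) gives (M,
det^{−1/2}/8); then det^{−1/2} − 1 = ∫_{det}^{1} ½t^{−3/2}dt (Newton–Leibniz backwards), Fubini, the
algebraic CoV Y = t^{1/3}Y′ (Jacobian t²) and one Newton–Leibniz in t (∫₀¹ ½t^{1/2} = 1/3) give (M,
(1 + 1/3)/8) = (M, 1/6). MC this session: ∫_M det^{−1/2} = 0.2679 ± 0.0004 vs (4/3)(ζ(3)/6) =
0.2671. [difficulty: M] -/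
@[route_item "route-KontsevichZagierPeriods-SiegelTamagawa"]
def ReducedBasesDensity : Prop :=
  ∀ (r r' : Literature.NumberTheory.Transcendental.KZ.IntegralRep 6), r.domain = {u : Fin 6 → ℝ | 0 < u 0 ∧ 0 < u 1 ∧ 0 < u 2 ∧ ![u 0 ^ 2, u 3 ^ 2 + u 1 ^ 2, u 4 ^ 2 + u 5 ^ 2 + u 2 ^ 2, u 0 * u 3, u 0 * u 4, u 3 * u 4 + u 1 * u 5] ∈ {y : Fin 6 → ℝ | 0 < y 0 ∧ 0 < Matrix.det !![y 0, y 3, y 4; y 3, y 1, y 5; y 4, y 5, y 2] ∧ Matrix.det !![y 0, y 3, y 4; y 3, y 1, y 5; y 4, y 5, y 2] < 1 ∧ ∀ (k : Fin 3) (a : Fin 3 → ℝ), (∀ j, a j = -1 ∨ a j = 0 ∨ a j = 1) → (∃ j, k ≤ j ∧ a j ≠ 0) → ![y 0, y 1, y 2] k ≤ y 0 * a 0 ^ 2 + y 1 * a 1 ^ 2 + y 2 * a 2 ^ 2 + 2 * (y 3 * a 0 * a 1 + y 4 * a 0 * a 2 + y 5 * a 1 * a 2)}} → Set.EqOn r.integrand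 (fun u => u 0 ^ 2 * u 1) r.domain → r'.domain = {y : Fin 6 → ℝ | 0 < y 0 ∧ 0 < Matrix.det !![y 0, y 3, y 4; y 3, y 1, y 5; y 4, y 5, y 2] ∧ Matrix.det !![y 0, y 3, y 4; y 3, y 1, y 5; y 4, y 5, y 2] < 1 ∧ ∀ (k : Fin 3) (a : Fin 3 → ℝ), (∀ j, a j = -1 ∨ a j = 0 ∨ a j = 1) → (∃ j, k ≤ j ∧ a j ≠ 0) → ![y 0, y 1, y 2] k ≤ y 0 * a 0 ^ 2 + y 1 * a 1 ^ 2 + y 2 * a 2 ^ 2 + 2 * (y 3 * a 0 * a 1 + y 4 * a 0 * a 2 + y 5 * a 1 * a 2)} → Set.EqOn r'.integrand (fun _ => 1 / 6) r'.domain → Literature.NumberTheory.Transcendental.KZ.Equivalent r r'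

/-- item stmt-KontsevichZagierPeriods-4421 · support · rank 9 · open · by planner
sources: Siegel1945, Siegel1936, Terras2016
[support] KNOWN THEOREM, unproved in Lean, hypothesis of the Assembly only (not imported from any
Literature fact; the route's import cone is proved): the body M has Lebesgue volume ζ(3)/6 = 4 × v₃,
v₃ = 2Λ(1)Λ(3/2)/4 = ζ(3)/24 (Minkowski 1905; Siegel1936; Siegel1945; Terras2016 Lemma 1.4.5 + Thm
1.4.4; the factor 4 = diagonal sign changes mod ±I, since M omits Minkowski's normalisation y₁₂, y₂₃
≥ 0). A direct formalisation (Siegel's integral formula for n = 3) is an XL but legitimate target; a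
move-chain proof of MinkowskiTernaryAccessible proves it as a corollary (Equivalent.value_eq_holds +
mzvRep_value_holds + multipleZeta_singleton_holds). If refuted as typed, the inequality list or the
constant was mis-transcribed (MC this session: 0.2003 ± 0.0004) — restate, not a kill. [difficulty:
XL] -/
@[route_item "route-KontsevichZagierPeriods-SiegelTamagawa", crux]
def MinkowskiTernaryVolume : Prop :=
  MeasureTheory.volume {y : Fin 6 → ℝ | 0 < y 0 ∧ 0 < Matrix.det !![y 0, y 3, y 4; y 3, y 1, y 5; y 4, y 5, y 2] ∧ Matrix.det !![y 0, y 3, y 4; y 3, y 1, y 5; y 4, y 5, y 2] < 1 ∧ ∀ (k : Fin 3) (a : Fin 3 → ℝ), (∀ j, a j = -1 ∨ a j = 0 ∨ a j = 1) → (∃ j, k ≤ j ∧ a j ≠ 0) → ![y 0, y 1, y 2] k ≤ y 0 * a 0 ^ 2 + y 1 * a 1 ^ 2 + y 2 * a 2 ^ 2 + 2 * (y 3 * a 0 * a 1 + y 4 * a 0 * a 2 + y 5 * a 1 * a 2)} = ENNReal.ofReal ((∑' n : ℕ, 1 / ((n : ℝ) + 1) ^ 3) / 6)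

-- earlier Assembly (stmt-KontsevichZagierPeriods-4422, replaced 2026-08-15T16:23:01Z -> stmt-KontsevichZagierPeriods-10746): retired by None — MinkowskiTernaryVolume → ¬ MinkowskiTernaryAccessible → ¬ KontsevichZagierPeriods
/-- item stmt-KontsevichZagierPeriods-10746 · assembly · rank 1 · closed · proved by Summit.KontsevichZagierPeriods.SiegelTamagawa.assembly_proof @ 224f4377a444 (prover) · by planner
sources: KontsevichZagier2001, Terras2016
[assembly] MinkowskiTernaryVolume → NotMinkowskiTernaryAccessible → ¬KontsevichZagierPeriods —
restated (route-repair 2026-08-15) over the named negative-side item instead of the inline `¬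
MinkowskiTernaryAccessible` (definitionally the same statement). Its content is PROVED in this file
as the deciding theorem `closes` (D-0027), so this item closes by the one-liner `theorem
Assembly_holds : Assembly := fun hV hN => closes hV hN` in a Theorems file; it is kept only because
an assembly item cannot be dropped. -/
@[route_item "route-KontsevichZagierPeriods-SiegelTamagawa"]
def Assembly : Prop :=
  MinkowskiTernaryVolume → NotMinkowskiTernaryAccessible → ¬ KontsevichZagierPeriods

/-! D-0027 §2.1 — DECIDING THEOREM (planner-authored via `route open/edit --closes-file`; by planner-rbadge-KontsevichZagierPeriods-SiegelT-b31b66e2-g2-0 2026-08-15T16:23:01Z):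
its hypotheses are this route's items and its conclusion the sub-problem Statement (glue_lint), and it elaborates with this file. -/

@[closes "route-KontsevichZagierPeriods-SiegelTamagawa"] theorem closes (hV : MinkowskiTernaryVolume) (hN : NotMinkowskiTernaryAccessible) :
    ¬ _root_.KontsevichZagierPeriods := by
  -- D-0027 deciding theorem, refutation form (route-repair 2026-08-15). The former `Assembly`
  -- item (MinkowskiTernaryVolume → ¬MinkowskiTernaryAccessible → ¬KZP) is PROVED here, so the
  -- route rests on exactly two items: Minkowski's value theorem vol M = ζ(3)/6 (support
  -- MinkowskiTernaryVolume) and the negative side of the rank-2 crux (NotMinkowskiTernaryAccessible).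
  -- Proof: both representations have KZ's literal rational shape (36/1 and 6/(X₀X₁(1−X₂)));
  -- r.value = 36·vol M = 6·Σ1/(n+1)³ by the volume item; r'.value = 6·∫_Δ ω₀ω₀ω₁ = 6·ζ(3) by the
  -- PROVED tree facts KZ.mzvRep_value_holds (Kontsevich's formula) and multipleZeta_singleton_holds;
  -- the summit statement then makes them KZ-equivalent, contradicting the negative item.
  intro hKZ
  apply hN
  intro r r' hr hri hr' hr'i
  have hS0 : (0 : ℝ) ≤ ∑' n : ℕ, 1 / ((n : ℝ) + 1) ^ 3 :=
    tsum_nonneg fun n => by positivity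
  -- (1) both representations have KZ's literal rational shape
  have h1 : r.IsRational := by
    refine ⟨MvPolynomial.C 36, 1, fun x _ => by simp, fun x hx => ?_⟩
    simp [hri hx]
  have h2 : r'.IsRational := by
    refine ⟨MvPolynomial.C 6, MvPolynomial.X 0 * MvPolynomial.X 1 * (1 - MvPolynomial.X 2),
      fun x hx => ?_, fun x hx => ?_⟩
    · rw [hr'] at hx
      obtain ⟨hx0, hx1, hx2, hx3⟩ := hx
      have hx0' : (0 : ℝ) < x 0 := by linarith
      have hx1' : (0 : ℝ) < x 1 := by linarith
      have hx2' : (0 : ℝ) < 1 - x 2 := by linarith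
      simp only [map_mul, map_sub, map_one, MvPolynomial.aeval_X]
      exact mul_ne_zero (mul_ne_zero hx0'.ne' hx1'.ne') hx2'.ne'
    · simp [hr'i hx]
  -- (2) the value of r : 36 · vol M = 36 · (ζ(3)/6)
  have hval : r.value = 6 * ∑' n : ℕ, 1 / ((n : ℝ) + 1) ^ 3 := by
    have hm : MeasurableSet r.domain :=
      Literature.NumberTheory.Transcendental.KZ.IntegralRep.measurableSet_domain_holds r
    have hc : ∫ x in r.domain, r.integrand x = ∫ x in r.domain, (36 : ℝ) :=
      setIntegral_congr_fun hm hri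
    have hvol : volume r.domain = ENNReal.ofReal ((∑' n : ℕ, 1 / ((n : ℝ) + 1) ^ 3) / 6) := by
      rw [hr]; exact hV
    show ∫ x in r.domain, r.integrand x = _
    rw [hc, setIntegral_const, smul_eq_mul, measureReal_def, hvol,
      ENNReal.toReal_ofReal (div_nonneg hS0 (by norm_num))]
    ring
  -- (3) the value of r' : 6 · ∫_Δ ω₀ω₀ω₁ = 6 · ζ(3) (Kontsevich's formula, proved in the tree)
  have hval' : r'.value = 6 * ∑' n : ℕ, 1 / ((n : ℝ) + 1) ^ 3 := by
    have hadm : Literature.NumberTheory.Transcendental.MZV.IsAdmissible [3] :=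
      ⟨fun i hi => by simp only [List.mem_singleton] at hi; omega, fun _ => by simp⟩
    have hsa := Literature.NumberTheory.Transcendental.KZ.mzvIntegrand_isSemialgebraicFunOn_holds [3]
    have hio := Literature.NumberTheory.Transcendental.KZ.mzvIntegrand_integrableOn_holds [3] hadm
    have hz : Literature.NumberTheory.Transcendental.multipleZeta [3]
        = ∑' n : ℕ, 1 / ((n : ℝ) + 1) ^ 3 :=
      Literature.NumberTheory.Transcendental.multipleZeta_singleton_holds (by norm_num)
    have hK : (∫ t in Literature.NumberTheory.Transcendental.KZ.openOrderedSimplex 3,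
        Literature.NumberTheory.Transcendental.KZ.mzvIntegrand [3] t)
        = ∑' n : ℕ, 1 / ((n : ℝ) + 1) ^ 3 := by
      have h := Literature.NumberTheory.Transcendental.KZ.mzvRep_value_holds [3] hadm hsa hio
      rw [Literature.NumberTheory.Transcendental.KZ.mzvRep_value_eq, hz] at h
      exact h
    have hdom : r'.domain = Literature.NumberTheory.Transcendental.KZ.openOrderedSimplex 3 := by
      rw [hr']
      ext t
      simp only [Literature.NumberTheory.Transcendental.KZ.openOrderedSimplex, Set.mem_setOf_eq]
      constructor
      · rintro ⟨ht0, ht1, ht2, ht3⟩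
        refine ⟨fun i => ?_, fun i => ?_, Fin.strictAnti_iff_succ_lt.mpr fun i => ?_⟩
        · rcases i with ⟨i, hi⟩
          interval_cases i
          · show 0 < t 0; linarith
          · show 0 < t 1; linarith
          · show 0 < t 2; linarith
        · rcases i with ⟨i, hi⟩
          interval_cases i
          · show t 0 < 1; linarith
          · show t 1 < 1; linarith
          · show t 2 < 1; linarith
        · rcases i with ⟨i, hi⟩
          interval_cases i
          · show t 1 < t 0; linarith
          · show t 2 < t 1; linarith
      · rintro ⟨hpos, hlt, hanti⟩
        exact ⟨hlt 0, hanti (by decide : (0 : Fin 3) < 1), hanti (by decide : (1 : Fin 3) < 2), hpos 2⟩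
    have hint : Set.EqOn r'.integrand
        (fun t => 6 * Literature.NumberTheory.Transcendental.KZ.mzvIntegrand [3] t) r'.domain := by
      intro t ht
      have hI := hr'i ht
      rw [hr'] at ht
      obtain ⟨ht0, ht1, ht2, ht3⟩ := ht
      rw [hI]
      show (6 : ℝ) / (t 0 * t 1 * (1 - t 2))
        = 6 * ∏ i : Fin 3, Literature.NumberTheory.Transcendental.KZ.mzvForm
            (([false, false, true] : List Bool).getD i false) (t i)
      rw [Fin.prod_univ_three, div_eq_mul_inv, mul_inv, mul_inv]
      simp [Literature.NumberTheory.Transcendental.KZ.mzvForm]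
    show ∫ t in r'.domain, r'.integrand t = _
    rw [setIntegral_congr_fun
      (Literature.NumberTheory.Transcendental.KZ.IntegralRep.measurableSet_domain_holds r') hint,
      integral_const_mul, hdom, hK]
  exact hKZ r r' h1 h2 (hval.trans hval'.symm)

end Summit.KontsevichZagierPeriods.KontsevichZagierPeriods.Theses.SiegelTamagawa
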